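import Mathlib.NumberTheory.LSeries.RiemannZeta
import Mathlib.NumberTheory.Chebyshev
import Mathlib.NumberTheory.ArithmeticFunction.Misc
import Mathlib.NumberTheory.Harmonic.Defs
import Mathlib.MeasureTheory.Function.LpSeminorm.Basic
import Mathlib.Analysis.Asymptotics.Defs
import Literature.NumberTheory.LFunctions.RHWave0
import HarnessLib

/-!
# Named facts: classical equivalents of the Riemann hypothesis (Wave-0 carry-over)

Grounder file (D-0014 named facts) for the route `RiemannHypothesis/InterimWave0`. Each
declaration is a published theorem of the form `RiemannHypothesis ↔ …` that the tree has not
proved, recorded as `def <name> : Prop := <statement as printed>` with its citation; routes take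
`(h : <name>)` and a later `theorem <name>_holds : <name>` discharges it. Nothing is asserted.
The statements are those of the interim `Statements/RH/Wave0.lean` (rh.S18, S19, S21, S24, S25,
S27); the glue `mertensFunction` lives in `Literature/…/RHWave0.lean`, `Chebyshev.psi/theta`,
`harmonic`, `eLpNorm` are Mathlib's.

## Contents (statement item ↦ fact)

* `speiser_iff` (rh.S18; stmt-RiemannHypothesis-0026).
* `riemannHypothesis_iff_chebyshevPsi_isBigO`, `riemannHypothesis_iff_chebyshevTheta_isBigO`
  (rh.S19; stmt-0027/0028).
* `riemannHypothesis_iff_mertensFunction_isBigO` (rh.S21; stmt-0029).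
* `robin_iff` (rh.S24; stmt-0030), `lagarias_iff` (rh.S25; stmt-0031).
* `baezDuarte_iff` (rh.S27; stmt-0032).

## References

* A. Speiser, *Geometrisches zur Riemannschen Zetafunktion*, Math. Ann. 110 (1934), 514–521;
  N. Levinson, H. L. Montgomery, *Zeros of the derivatives of the Riemann zeta-function*, Acta
  Math. 133 (1974), 49–65, Thm. 1.
* H. von Koch, Acta Math. 24 (1901), 159–182; H. L. Montgomery, R. C. Vaughan, *Multiplicative
  Number Theory I*, CUP 2007, Thm. 13.1 (and §15.1 for the converse).
* J. E. Littlewood, *Quelques conséquences de l'hypothèse que la fonction ζ(s) n'a pas de zéros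
  dans le demi-plan Re(s) > 1/2*, C. R. Acad. Sci. Paris 154 (1912), 263–266; E. C. Titchmarsh,
  *The Theory of the Riemann Zeta-Function*, 2nd ed., Thm. 14.25 (C).
* G. Robin, *Grandes valeurs de la fonction somme des diviseurs et hypothèse de Riemann*, J. Math.
  Pures Appl. 63 (1984), 187–213, Thm. 1.
* J. C. Lagarias, *An elementary problem equivalent to the Riemann hypothesis*, Amer. Math.
  Monthly 109 (2002), 534–543, Thm. 1.1.
* L. Báez-Duarte, *A strengthening of the Nyman–Beurling criterion for the Riemann hypothesis*,
  Atti Accad. Naz. Lincei Rend. Lincei (9) Mat. Appl. 14 (2003), 5–11, Thm. 1.1; B. Nyman, thesis,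
  Uppsala 1950; A. Beurling, Proc. Nat. Acad. Sci. 41 (1955).
-/

noncomputable section

open Complex Filter Asymptotics MeasureTheory
open scoped Real Topology

namespace Literature.NumberTheory.LFunctions

/-- **rh.S18** NAMED FACT (Speiser's theorem; A. Speiser, Math. Ann. 110 (1934), 514–521;
reproved and quantified by Levinson–Montgomery, Acta Math. 133 (1974), Thm. 1: `ζ` and `ζ'` have
the same number of zeros in `0 < σ < 1/2`, `0 < t < T`, up to `O(log T)`… and "RH is equivalent
to `ζ'(s)` having no zeros in `0 < σ < 1/2`"). The Riemann hypothesis holds if and only if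
`ζ'` has no zeros in the open half-strip `0 < Re s < 1/2`. Users take `(h : speiser_iff)`. [cite: Speiser1934, Satz (via LevinsonMontgomery1974 Thm 1)] -/
def speiser_iff : Prop :=
  RiemannHypothesis ↔ ∀ s : ℂ, 0 < s.re → s.re < 1 / 2 → deriv riemannZeta s ≠ 0

/-- **rh.S19** NAMED FACT (von Koch; H. von Koch, Acta Math. 24 (1901): RH implies
`ψ(x) = x + O(√x log² x)`; the converse — such an error term makes `−ζ'/ζ(s) − 1/(s−1)`
analytic on `Re s > 1/2` — is classical, Montgomery–Vaughan, *Multiplicative Number Theory I*,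
Thm. 13.1 and §15.1). RH iff `ψ(x) − x = O(x^{1/2} log² x)` as `x → ∞`, `ψ = Chebyshev.psi`
(Mathlib). Users take `(h : riemannHypothesis_iff_chebyshevPsi_isBigO)`. [cite: Koch1901, main theorem (ψ form)] -/
def riemannHypothesis_iff_chebyshevPsi_isBigO : Prop :=
  RiemannHypothesis ↔
    (fun x ↦ Chebyshev.psi x - x) =O[atTop] fun x ↦ x ^ (1 / 2 : ℝ) * Real.log x ^ 2

/-- **rh.S19** NAMED FACT (von Koch 1901, `θ` form; since `ψ(x) − θ(x) = O(√x)`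
(Chebyshev), the `θ` statement is equivalent to the `ψ` statement; Montgomery–Vaughan Thm. 13.1
states both under RH). RH iff `θ(x) − x = O(x^{1/2} log² x)`, `θ = Chebyshev.theta` (Mathlib).
Users take `(h : riemannHypothesis_iff_chebyshevTheta_isBigO)`. [cite: Koch1901, main theorem (θ form)] -/
def riemannHypothesis_iff_chebyshevTheta_isBigO : Prop :=
  RiemannHypothesis ↔
    (fun x ↦ Chebyshev.theta x - x) =O[atTop] fun x ↦ x ^ (1 / 2 : ℝ) * Real.log x ^ 2

/-- **rh.S21** NAMED FACT (Littlewood's criterion; J. E. Littlewood, C. R. Acad. Sci. Paris 154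
(1912), 263–266; Titchmarsh, *The Theory of the Riemann Zeta-Function*, Thm. 14.25 (C)). RH iff
the Mertens function satisfies `M(x) = O_ε(x^{1/2+ε})` for every `ε > 0`
(`M = mertensFunction`, `∑_{1 ≤ n ≤ x} μ(n)`). Users take
`(h : riemannHypothesis_iff_mertensFunction_isBigO)`. [cite: Littlewood1912, Théorème (Titchmarsh Thm 14.25 C)] -/
def riemannHypothesis_iff_mertensFunction_isBigO : Prop :=
  RiemannHypothesis ↔
    ∀ ε : ℝ, 0 < ε → (fun x ↦ (mertensFunction x : ℝ)) =O[atTop] fun x ↦ x ^ (1 / 2 + ε)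

/-- **rh.S24** NAMED FACT (Robin's criterion; G. Robin, J. Math. Pures Appl. 63 (1984),
187–213, Thm. 1). RH iff `σ(n) < e^γ n log log n` for every `n ≥ 5041` (i.e. `n > 5040`),
`σ = ArithmeticFunction.sigma 1`, `γ = Real.eulerMascheroniConstant`. Users take
`(h : robin_iff)`. [cite: Robin1984, Thm. 1] -/
def robin_iff : Prop :=
  RiemannHypothesis ↔
    ∀ n : ℕ, 5040 < n →
      (ArithmeticFunction.sigma 1 n : ℝ) <
        Real.exp Real.eulerMascheroniConstant * n * Real.log (Real.log n)

/-- **rh.S25** NAMED FACT (Lagarias's criterion; J. C. Lagarias, Amer. Math. Monthly 109 (2002),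
534–543, Thm. 1.1). RH iff `σ(n) ≤ H_n + exp(H_n) log(H_n)` for every `n ≥ 1` (with equality
only for `n = 1`), `H_n = harmonic n` (Mathlib, `ℚ`-valued, cast to `ℝ`). Users take
`(h : lagarias_iff)`. [cite: Lagarias2002, Thm. 1.1] -/
def lagarias_iff : Prop :=
  RiemannHypothesis ↔
    ∀ n : ℕ, 1 ≤ n →
      (ArithmeticFunction.sigma 1 n : ℝ) ≤
        (harmonic n : ℝ) + Real.exp (harmonic n) * Real.log (harmonic n)

/-- **rh.S27** NAMED FACT (Nyman–Beurling–Báez-Duarte criterion; L. Báez-Duarte, Rend. Lincei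
(9) 14 (2003), 5–11, Thm. 1.1: "RH is equivalent to `χ ∈ closure(B_nat)`", where, in
`L²((0, ∞), dx)`, `χ = 𝟙_{(0,1]}` and `B_nat` is the linear span of `ρ_a(x) = {1/(a x)}`,
`a ∈ ℕ`, `{·}` the fractional part; Nyman 1950 / Beurling 1955 for real dilations). Spelled out:
for every `ε > 0` there are `N` and real coefficients `c_1, …, c_N` with
`‖𝟙_{(0,1]} − ∑_{k ≤ N} c_k {1/(k x)}‖_{L²(0,∞)} < ε` (real coefficients suffice since all
functions are real-valued). Users take `(h : baezDuarte_iff)`. [cite: BaezDuarte2003, Thm. 1.1] -/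
def baezDuarte_iff : Prop :=
  RiemannHypothesis ↔
    ∀ ε : ℝ, 0 < ε → ∃ (N : ℕ) (c : Fin N → ℝ),
      eLpNorm (fun x : ℝ ↦ (Set.Ioc (0 : ℝ) 1).indicator 1 x -
          ∑ k : Fin N, c k * Int.fract (1 / (((k : ℕ) + 1 : ℝ) * x))) 2
        (volume.restrict (Set.Ioi 0)) < ENNReal.ofReal ε


/-- **rh.S27, Mellin form** NAMED FACT (Nyman–Beurling–Báez-Duarte criterion on the critical
line; L. Báez-Duarte, Rend. Lincei (9) 14 (2003), 5–11, Thm. 1.1 stated through the distances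
`d_N`, with `d_N² = inf_{A_N} (1/2π) ∫_ℝ |1 − ζ(1/2+it) A_N(1/2+it)|² dt/(1/4+t²)`, `A_N` ranging over
Dirichlet polynomials `∑_{k ≤ N} a_k k^{-s}`; Báez-Duarte–Balazard–Landreau–Saias, "Notes sur la
fonction ζ de Riemann, 3", Adv. Math. 149 (2000), §1 for the Mellin–Plancherel identification
`2π · dist²_{L²(0,∞)}(χ_(0,1], span{ρ(1/(kx)) : k ≤ N}) = ∫ |1 − ζ A_N|²/(1/4+t²)` using
`M[χ](s) = 1/s`, `M[ρ(1/(k·))](s) = −ζ(s)/(k^s s)`). RH holds iff `d_N → 0`, i.e. iff for every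
`ε > 0` some Dirichlet polynomial `A(s) = ∑_{n<N} a_n (n+1)^{-s}` (complex coefficients) makes
`∫_ℝ |1 − ζ(1/2+it) A(1/2+it)|² dt/(1/4+t²) < ε`. Written with the lower Lebesgue integral `∫⁻`
(no integrability side condition; the integrand is integrable by the second moment of `ζ` on the
critical line, Titchmarsh Thm. 7.3). Companion of `baezDuarte_iff` (function-space form); the two
right-hand sides agree by Mellin–Plancherel. Users take `(h : baezDuarte_dirichlet_iff)`;
route `RiemannHypothesis/NymanBeurling`, items stmt-RiemannHypothesis-0392/0393/0396. [cite: BaezDuarte2003, Thm. 1.1] -/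
def baezDuarte_dirichlet_iff : Prop :=
  RiemannHypothesis ↔
    ∀ ε : ℝ, 0 < ε → ∃ (N : ℕ) (a : Fin N → ℂ),
      ∫⁻ t : ℝ, ENNReal.ofReal (‖1 - riemannZeta (1 / 2 + t * Complex.I) *
          ∑ n : Fin N, a n * ((n : ℂ) + 1) ^ (-(1 / 2 + t * Complex.I))‖ ^ 2 / (1 / 4 + t ^ 2)) <
        ENNReal.ofReal ε

end Literature.NumberTheory.LFunctions

end
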